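import Mathlib
import HarnessLib
import Summits.ResolutionOfSingularities.ResolutionOfSingularities.Theorems.WildQuotientsWildQuotientResolutionS1aCuspRecentre
import Summits.ResolutionOfSingularities.ResolutionOfSingularities.Theorems.WildQuotientsWildQuotientResolutionS1aQhSymRootData
import Summits.ResolutionOfSingularities.ResolutionOfSingularities.Theorems.WildQuotientsWildQuotientResolutionS1aQhInvRootData

/-!
# S1a — R4c cusp, the per-point RING DATA of move 1 at a common degree, as one `Fin 2`-family (`Cusp.cusp_ringData`)

[OURS · L1 W4.5c · crux stmt-ResolutionOfSingularities-17941 `CyclicQuotientFourfolds`, line `s1a-logminvertex` v13 (`stub_reachLowerInFX`); R4c cusp,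
assembly step (b6) of `Lines/s1a_logminvertex-R4c-PROGRESS.md` §4] — NOT a statement of the manuscript; counted 0; AI-level work, weaker than expert review.

✓`QhSym.qs_ringData'` (point `O`: cover `(x₀^n₀, N(x₁)^n₁, N(x₂)^n₂)`, weights `(9,2,3)`, shift `6`) and ✓`QhAway.qhv_ringData'` (point `Q`: cover
`(x₀^n₀, N(y)^n₁, v^(p n₂))`, weights `(3,1,2)`, shift `2`) as ONE statement indexed by `i : Fin 2` at a common degree `dbar = w₀n₀ = p·w₁n₁ = p·w₂n₂`:
the third cover element is written uniformly as `(∏ₗ (u₂′ + κᵢ·l·u₀′·s^(w₀−w₂)))^n₂` with `κ = (1, 0)ᵢ` (at `Q` it is `(v′^p)^n₂`). Companion of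
✓`GameFrame.GModel.exists_cusp_pointCentre` and ✓`Cusp.cusp_pointFacts`: together they let the assembly `cusp_killsIn_two` feed
✓`exists_moveAtlas_of_nodes` with `choose`-built families exactly as ✓`graphTail_killsIn_two` does.
-/

set_option linter.dupNamespace false

noncomputable section

open Literature.AlgebraicGeometry.Resolution
open scoped LaurentPolynomial
open MvPolynomial
open Summit.ResolutionOfSingularities.ResolutionOfSingularities.Theorems.WildQuotientResolution.S1
open Summit.ResolutionOfSingularities.ResolutionOfSingularities.Theorems.WildQuotientResolution.S1.CoarseChart
open Summit.ResolutionOfSingularities.ResolutionOfSingularities.Theorems.WildQuotientResolution.S1.NodeAway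
open Summit.ResolutionOfSingularities.ResolutionOfSingularities.Theorems.WildQuotientResolution.S1.CentreAway
open Summit.ResolutionOfSingularities.ResolutionOfSingularities.Theorems.WildQuotientResolution.S1.BlowupCharts
open Summit.ResolutionOfSingularities.ResolutionOfSingularities.Theorems.WildQuotientResolution.S1.GameFrame.GModel
open Summit.ResolutionOfSingularities.ResolutionOfSingularities.Theorems.WildQuotientResolution.S1.KillCert

namespace Summit.ResolutionOfSingularities.ResolutionOfSingularities.Theorems.WildQuotientResolution.S1.KillCert.Cusp

variable {k : Type} [Field k]

set_option maxHeartbeats 4000000 in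
/-- ★ **R4c MOVE 1: the ring data of both point roots at a common degree, as one `Fin 2`-family** (`i = 0`: `O`, ✓`QhSym.qs_ringData'`; `i = 1`:
`Q`, ✓`QhAway.qhv_ringData'` with `n₂ ↦ p·n₂`). Tables: rows `x₂ ↦ (x₂ + x₀, x₂)ᵢ`, tails `(x₂² − x₁³, T_Q)ᵢ`, weights `((9,2,3),(3,1,2))ᵢ`, shift `(6,2)ᵢ`,
`κ = (1,0)ᵢ`. [OURS · L1 W4.5c · R4c (b6); NOT a statement of the manuscript] -/
theorem cusp_ringData {p : ℕ} [Fact p.Prime] [CharP k p] (hp : 0 < p) (a c : k)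
    (σ : (MvPolynomial (Fin 4) k) ≃+* (MvPolynomial (Fin 4) k)) (hC : ∀ a : k, σ (C a) = C a)
    (h0 : σ (X 0) = X 0) (h1 : σ (X 1) = X 1 + X 0) (i : Fin 2)
    (h2 : σ (X 2) = (![X 2 + X 0, X 2] : Fin 2 → (MvPolynomial (Fin 4) k)) i)
    (h3 : σ (X 3) = X 3 + ((![(X 2 ^ 2 - X 1 ^ 3 : MvPolynomial (Fin 4) k), (X 2 ^ 2 + 2 * X 1 * X 2 + C (2 * c) * X 2 + C (1 - 3 * a) * X 1 ^ 2 - X 1 ^ 3 : MvPolynomial (Fin 4) k)] : Fin 2 → (MvPolynomial (Fin 4) k)) i))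
    (hh : (MvPolynomial (Fin 4) k)) (hσh : σ hh = hh) (hh0 : hh ≠ 0) (hσp : ∀ x : (MvPolynomial (Fin 4) k), (⇑σ)^[p] x = x)
    (hσpL : ∀ y : (Localization.Away hh), (⇑(sigmaAway σ hσh))^[p] y = y)
    (hσJ : ∀ n : ℕ, ((weightedFiltration (fun l => algebraMap (MvPolynomial (Fin 4) k) (Localization.Away hh) (X ((![0, 1, 2] : Fin 3 → Fin 4) l))) ((![(![9, 2, 3] : Fin 3 → ℕ), (![3, 1, 2] : Fin 3 → ℕ)] : Fin 2 → (Fin 3 → ℕ)) i)).ideal n).map ((sigmaAway σ hσh) : (Localization.Away hh) →+* (Localization.Away hh)) ≤ (weightedFiltration (fun l => algebraMap (MvPolynomial (Fin 4) k) (Localization.Away hh) (X ((![0, 1, 2] : Fin 3 → Fin 4) l))) ((![(![9, 2, 3] : Fin 3 → ℕ), (![3, 1, 2] : Fin 3 → ℕ)] : Fin 2 → (Fin 3 → ℕ)) i)).ideal n)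
    {mg : ℕ} (mo : Fin mg → ℕ) (𝒜 : (Π j : Fin mg, ZMod (mo j)) → AddSubgroup (Localization.Away hh)) [GradedRing 𝒜] (h𝒜 : ∀ x : (Localization.Away hh), x ∈ 𝒜 0)
    (dbar n₀ n₁ n₂ : ℕ) (hn₀ : 0 < n₀) (hn₁ : 0 < n₁) (hn₂ : 0 < n₂)
    (hd₀ : dbar = ((![(![9, 2, 3] : Fin 3 → ℕ), (![3, 1, 2] : Fin 3 → ℕ)] : Fin 2 → (Fin 3 → ℕ)) i) 0 * n₀) (hd₁ : dbar = p * ((![(![9, 2, 3] : Fin 3 → ℕ), (![3, 1, 2] : Fin 3 → ℕ)] : Fin 2 → (Fin 3 → ℕ)) i) 1 * n₁) (hd₂ : dbar = p * ((![(![9, 2, 3] : Fin 3 → ℕ), (![3, 1, 2] : Fin 3 → ℕ)] : Fin 2 → (Fin 3 → ℕ)) i) 2 * n₂) :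
    ∃ (y : Fin 3 → ↥(𝒜 0)) (hy : ∀ j, y j ∈ (traceFiltration 𝒜 (fun l => algebraMap (MvPolynomial (Fin 4) k) (Localization.Away hh) (X ((![0, 1, 2] : Fin 3 → Fin 4) l))) ((![(![9, 2, 3] : Fin 3 → ℕ), (![3, 1, 2] : Fin 3 → ℕ)] : Fin 2 → (Fin 3 → ℕ)) i)).ideal dbar),
      (∀ j, (sigmaAway σ hσh) (y j : (Localization.Away hh)) = y j) ∧
      ((y 0 : (Localization.Away hh)) = (fun l => algebraMap (MvPolynomial (Fin 4) k) (Localization.Away hh) (X ((![0, 1, 2] : Fin 3 → Fin 4) l))) 0 ^ n₀) ∧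
      ((y 1 : (Localization.Away hh)) = (∏ l : ZMod p, ((fun l => algebraMap (MvPolynomial (Fin 4) k) (Localization.Away hh) (X ((![0, 1, 2] : Fin 3 → Fin 4) l))) 1 + (l.val : (Localization.Away hh)) * (fun l => algebraMap (MvPolynomial (Fin 4) k) (Localization.Away hh) (X ((![0, 1, 2] : Fin 3 → Fin 4) l))) 0)) ^ n₁) ∧
      ((y 2 : (Localization.Away hh)) = (∏ l : ZMod p, ((fun l => algebraMap (MvPolynomial (Fin 4) k) (Localization.Away hh) (X ((![0, 1, 2] : Fin 3 → Fin 4) l))) 2 + (((![1, 0] : Fin 2 → ℕ) i : ℕ) : (Localization.Away hh)) * ((l.val : (Localization.Away hh)) * (fun l => algebraMap (MvPolynomial (Fin 4) k) (Localization.Away hh) (X ((![0, 1, 2] : Fin 3 → Fin 4) l))) 0))) ^ n₂) ∧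
      coverElement 𝒜 (fun l => algebraMap (MvPolynomial (Fin 4) k) (Localization.Away hh) (X ((![0, 1, 2] : Fin 3 → Fin 4) l))) ((![(![9, 2, 3] : Fin 3 → ℕ), (![3, 1, 2] : Fin 3 → ℕ)] : Fin 2 → (Fin 3 → ℕ)) i) dbar (y 0) (hy 0) = cobordantAlgebra.u' (fun l => algebraMap (MvPolynomial (Fin 4) k) (Localization.Away hh) (X ((![0, 1, 2] : Fin 3 → Fin 4) l))) ((![(![9, 2, 3] : Fin 3 → ℕ), (![3, 1, 2] : Fin 3 → ℕ)] : Fin 2 → (Fin 3 → ℕ)) i) 0 ^ n₀ ∧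
      coverElement 𝒜 (fun l => algebraMap (MvPolynomial (Fin 4) k) (Localization.Away hh) (X ((![0, 1, 2] : Fin 3 → Fin 4) l))) ((![(![9, 2, 3] : Fin 3 → ℕ), (![3, 1, 2] : Fin 3 → ℕ)] : Fin 2 → (Fin 3 → ℕ)) i) dbar (y 1) (hy 1) = (∏ l : ZMod p, (cobordantAlgebra.u' (fun l => algebraMap (MvPolynomial (Fin 4) k) (Localization.Away hh) (X ((![0, 1, 2] : Fin 3 → Fin 4) l))) ((![(![9, 2, 3] : Fin 3 → ℕ), (![3, 1, 2] : Fin 3 → ℕ)] : Fin 2 → (Fin 3 → ℕ)) i) 1 + algebraMap (Localization.Away hh) ↥(cobordantAlgebra (fun l => algebraMap (MvPolynomial (Fin 4) k) (Localization.Away hh) (X ((![0, 1, 2] : Fin 3 → Fin 4) l))) ((![(![9, 2, 3] : Fin 3 → ℕ), (![3, 1, 2] : Fin 3 → ℕ)] : Fin 2 → (Fin 3 → ℕ)) i)) (l.val : (Localization.Away hh)) * (cobordantAlgebra.u' (fun l => algebraMap (MvPolynomial (Fin 4) k) (Localization.Away hh) (X ((![0, 1, 2] : Fin 3 → Fin 4)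 l))) ((![(![9, 2, 3] : Fin 3 → ℕ), (![3, 1, 2] : Fin 3 → ℕ)] : Fin 2 → (Fin 3 → ℕ)) i) 0 * cobordantAlgebra.s (fun l => algebraMap (MvPolynomial (Fin 4) k) (Localization.Away hh) (X ((![0, 1, 2] : Fin 3 → Fin 4) l))) ((![(![9, 2, 3] : Fin 3 → ℕ), (![3, 1, 2] : Fin 3 → ℕ)] : Fin 2 → (Fin 3 → ℕ)) i) ^ (((![(![9, 2, 3] : Fin 3 → ℕ), (![3, 1, 2] : Fin 3 → ℕ)] : Fin 2 → (Fin 3 → ℕ)) i) 0 - ((![(![9, 2, 3] : Fin 3 → ℕ), (![3, 1, 2] : Fin 3 → ℕ)] : Fin 2 → (Fin 3 → ℕ)) i) 1)))) ^ n₁ ∧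
      coverElement 𝒜 (fun l => algebraMap (MvPolynomial (Fin 4) k) (Localization.Away hh) (X ((![0, 1, 2] : Fin 3 → Fin 4) l))) ((![(![9, 2, 3] : Fin 3 → ℕ), (![3, 1, 2] : Fin 3 → ℕ)] : Fin 2 → (Fin 3 → ℕ)) i) dbar (y 2) (hy 2) = (∏ l : ZMod p, (cobordantAlgebra.u' (fun l => algebraMap (MvPolynomial (Fin 4) k) (Localization.Away hh) (X ((![0, 1, 2] : Fin 3 → Fin 4) l))) ((![(![9, 2, 3] : Fin 3 → ℕ), (![3, 1, 2] : Fin 3 → ℕ)] : Fin 2 → (Fin 3 → ℕ)) i) 2 + algebraMap (Localization.Away hh) ↥(cobordantAlgebra (fun l => algebraMap (MvPolynomial (Fin 4) k) (Localization.Away hh) (X ((![0, 1, 2] : Fin 3 → Fin 4) l))) ((![(![9, 2, 3] : Fin 3 → ℕ), (![3, 1, 2] : Fin 3 → ℕ)] : Fin 2 → (Fin 3 → ℕ)) i)) ((((![1, 0] : Fin 2 → ℕ) i : ℕ) : (Localization.Away hh)) * (l.val : (Localization.Away hh))) * (cobordantAlgebra.u' (fun l => algebraMap (MvPolynomial (Fin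 4) k) (Localization.Away hh) (X ((![0, 1, 2] : Fin 3 → Fin 4) l))) ((![(![9, 2, 3] : Fin 3 → ℕ), (![3, 1, 2] : Fin 3 → ℕ)] : Fin 2 → (Fin 3 → ℕ)) i) 0 * cobordantAlgebra.s (fun l => algebraMap (MvPolynomial (Fin 4) k) (Localization.Away hh) (X ((![0, 1, 2] : Fin 3 → Fin 4) l))) ((![(![9, 2, 3] : Fin 3 → ℕ), (![3, 1, 2] : Fin 3 → ℕ)] : Fin 2 → (Fin 3 → ℕ)) i) ^ (((![(![9, 2, 3] : Fin 3 → ℕ), (![3, 1, 2] : Fin 3 → ℕ)] : Fin 2 → (Fin 3 → ℕ)) i) 0 - ((![(![9, 2, 3] : Fin 3 → ℕ), (![3, 1, 2] : Fin 3 → ℕ)] : Fin 2 → (Fin 3 → ℕ)) i) 2)))) ^ n₂ ∧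
      (∀ l : Fin 3, cobordantAlgebra.u' (fun l => algebraMap (MvPolynomial (Fin 4) k) (Localization.Away hh) (X ((![0, 1, 2] : Fin 3 → Fin 4) l))) ((![(![9, 2, 3] : Fin 3 → ℕ), (![3, 1, 2] : Fin 3 → ℕ)] : Fin 2 → (Fin 3 → ℕ)) i) l ∈ (Ideal.span (Set.range fun j => coverElement 𝒜 (fun l => algebraMap (MvPolynomial (Fin 4) k) (Localization.Away hh) (X ((![0, 1, 2] : Fin 3 → Fin 4) l))) ((![(![9, 2, 3] : Fin 3 → ℕ), (![3, 1, 2] : Fin 3 → ℕ)] : Fin 2 → (Fin 3 → ℕ)) i) dbar (y j) (hy j))).radical) ∧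
      (∀ j : Fin 3,
        algebraMap ↥(cobordantAlgebra (fun l => algebraMap (MvPolynomial (Fin 4) k) (Localization.Away hh) (X ((![0, 1, 2] : Fin 3 → Fin 4) l))) ((![(![9, 2, 3] : Fin 3 → ℕ), (![3, 1, 2] : Fin 3 → ℕ)] : Fin 2 → (Fin 3 → ℕ)) i)) (ChartRing 𝒜 (fun l => algebraMap (MvPolynomial (Fin 4) k) (Localization.Away hh) (X ((![0, 1, 2] : Fin 3 → Fin 4) l))) ((![(![9, 2, 3] : Fin 3 → ℕ), (![3, 1, 2] : Fin 3 → ℕ)] : Fin 2 → (Fin 3 → ℕ)) i) dbar (y j) (hy j)) (cobordantAlgebra.u' (fun l => algebraMap (MvPolynomial (Fin 4) k) (Localization.Away hh) (X ((![0, 1, 2] : Fin 3 → Fin 4) l))) ((![(![9, 2, 3] : Fin 3 → ℕ), (![3, 1, 2] : Fin 3 → ℕ)] : Fin 2 → (Fin 3 → ℕ)) i) 0 ^ n₀) * IsLocalization.Away.invSelf (coverElement 𝒜 (fun l => algebraMap (MvPolynomial (Fin 4) k) (Localization.Away hh) (X ((![0, 1, 2] : Fin 3 → Fin 4) l))) ((![(![9,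 2, 3] : Fin 3 → ℕ), (![3, 1, 2] : Fin 3 → ℕ)] : Fin 2 → (Fin 3 → ℕ)) i) dbar (y j) (hy j)) ∈ chartNodeGrading mo 𝒜 (fun l => algebraMap (MvPolynomial (Fin 4) k) (Localization.Away hh) (X ((![0, 1, 2] : Fin 3 → Fin 4) l))) ((![(![9, 2, 3] : Fin 3 → ℕ), (![3, 1, 2] : Fin 3 → ℕ)] : Fin 2 → (Fin 3 → ℕ)) i) (fun _ => h𝒜 _) dbar (y j) (hy j) 0 ∧
        algebraMap ↥(cobordantAlgebra (fun l => algebraMap (MvPolynomial (Fin 4) k) (Localization.Away hh) (X ((![0, 1, 2] : Fin 3 → Fin 4) l))) ((![(![9, 2, 3] : Fin 3 → ℕ), (![3, 1, 2] : Fin 3 → ℕ)] : Fin 2 → (Fin 3 → ℕ)) i)) (ChartRing 𝒜 (fun l => algebraMap (MvPolynomial (Fin 4) k) (Localization.Away hh) (X ((![0, 1, 2] : Fin 3 → Fin 4) l))) ((![(![9, 2, 3] : Fin 3 → ℕ), (![3, 1, 2] : Fin 3 → ℕ)] : Fin 2 → (Fin 3 → ℕ)) i) dbar (y j) (hy j))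 (cobordantAlgebra.u' (fun l => algebraMap (MvPolynomial (Fin 4) k) (Localization.Away hh) (X ((![0, 1, 2] : Fin 3 → Fin 4) l))) ((![(![9, 2, 3] : Fin 3 → ℕ), (![3, 1, 2] : Fin 3 → ℕ)] : Fin 2 → (Fin 3 → ℕ)) i) 0 ^ n₀) * IsLocalization.Away.invSelf (coverElement 𝒜 (fun l => algebraMap (MvPolynomial (Fin 4) k) (Localization.Away hh) (X ((![0, 1, 2] : Fin 3 → Fin 4) l))) ((![(![9, 2, 3] : Fin 3 → ℕ), (![3, 1, 2] : Fin 3 → ℕ)] : Fin 2 → (Fin 3 → ℕ)) i) dbar (y j) (hy j)) ∈ (((augmentationIdeal (sigmaR (sigmaAway σ hσh) (fun l => algebraMap (MvPolynomial (Fin 4) k) (Localization.Away hh) (X ((![0, 1, 2] : Fin 3 → Fin 4) l))) ((![(![9, 2, 3] : Fin 3 → ℕ), (![3, 1, 2] : Fin 3 → ℕ)] : Fin 2 → (Fin 3 → ℕ)) i) hσJ hp hσpL)).colon (Ideal.span {cobordantAlgebra.s (fun l => algebraMap (MvPolynomial (Fin 4) k) (Localization.Away hh) (X ((![0, 1, 2]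 : Fin 3 → Fin 4) l))) ((![(![9, 2, 3] : Fin 3 → ℕ), (![3, 1, 2] : Fin 3 → ℕ)] : Fin 2 → (Fin 3 → ℕ)) i) ^ ((![6, 2] : Fin 2 → ℕ) i)}))).map (algebraMap ↥(cobordantAlgebra (fun l => algebraMap (MvPolynomial (Fin 4) k) (Localization.Away hh) (X ((![0, 1, 2] : Fin 3 → Fin 4) l))) ((![(![9, 2, 3] : Fin 3 → ℕ), (![3, 1, 2] : Fin 3 → ℕ)] : Fin 2 → (Fin 3 → ℕ)) i)) (ChartRing 𝒜 (fun l => algebraMap (MvPolynomial (Fin 4) k) (Localization.Away hh) (X ((![0, 1, 2] : Fin 3 → Fin 4) l))) ((![(![9, 2, 3] : Fin 3 → ℕ), (![3, 1, 2] : Fin 3 → ℕ)] : Fin 2 → (Fin 3 → ℕ)) i) dbar (y j) (hy j)))) := by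
  revert h2 h3 hσJ hd₀ hd₁ hd₂
  refine Fin.cases ?_ (fun j => Fin.cases ?_ (fun l => l.elim0) j) i
  · -- the point `O`
    intro h2 h3 hσJ hd₀ hd₁ hd₂
    have hw1 : (![9, 2, 3] : Fin 3 → ℕ) 1 + 6 ≤ (![9, 2, 3] : Fin 3 → ℕ) 0 := by decide
    have hw2 : (![9, 2, 3] : Fin 3 → ℕ) 0 = (![9, 2, 3] : Fin 3 → ℕ) 2 + 6 := by decide
    have h2' : σ (X 2) = X 2 + X 0 := h2
    have h3' : σ (X 3) = X 3 + (X 2 ^ 2 - X 1 ^ 3 : MvPolynomial (Fin 4) k) := h3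
    obtain ⟨y, hy, hσy, hy0, hy1, hy2, hc0, hc1, hc2, hrad, hres⟩ := QhSym.qs_ringData' σ hC h0 h1 h2' (X 2 ^ 2 - X 1 ^ 3 : MvPolynomial (Fin 4) k) h3'
      (![9, 2, 3] : Fin 3 → ℕ) 6 hw1 hw2 Cusp.cuspTail_mem hh hσh hp hσpL hσJ mo 𝒜 h𝒜 hσp hh0 dbar n₀ n₁ n₂ hn₀ hn₁ hn₂ hd₀ hd₁ hd₂
    refine ⟨y, hy, hσy, hy0, hy1, ?_, hc0, hc1, ?_, hrad, hres⟩
    · rw [hy2]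
      refine congrArg (· ^ n₂) (Finset.prod_congr rfl fun l _ => ?_)
      simp only [Matrix.cons_val_zero, Nat.cast_one, one_mul]
    · refine hc2.trans (congrArg (· ^ n₂) (Finset.prod_congr rfl fun l _ => ?_))
      simp only [Matrix.cons_val_zero, Nat.cast_one, one_mul]
      rfl
  · -- the tangency point `Q`
    intro h2 h3 hσJ hd₀ hd₁ hd₂
    have hw0 : (![3, 1, 2] : Fin 3 → ℕ) 0 = (![3, 1, 2] : Fin 3 → ℕ) 1 + 2 := by decide
    have h2' : σ (X 2) = X 2 := h2
    have h3' : σ (X 3) = X 3 + (X 2 ^ 2 + 2 * X 1 * X 2 + C (2 * c) * X 2 + C (1 - 3 * a) * X 1 ^ 2 - X 1 ^ 3 : MvPolynomial (Fin 4) k) := h3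
    have hd₂' : dbar = (![3, 1, 2] : Fin 3 → ℕ) 2 * (p * n₂) := by
      rw [hd₂]; change p * 2 * n₂ = 2 * (p * n₂); ring
    obtain ⟨y, hy, hσy, hy0, hy1, hy2, hc0, hc1, hc2, hrad, hres⟩ := QhAway.qhv_ringData' σ h0 h1 h2'
      (X 2 ^ 2 + 2 * X 1 * X 2 + C (2 * c) * X 2 + C (1 - 3 * a) * X 1 ^ 2 - X 1 ^ 3 : MvPolynomial (Fin 4) k) h3'
      (![3, 1, 2] : Fin 3 → ℕ) 2 hw0 hh hσh hp hσpL hσJ mo 𝒜 h𝒜 hσp hh0 dbar n₀ n₁ (p * n₂) hn₀ hn₁ hd₀ hd₁ hd₂'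
    haveI : NeZero p := ⟨hp.ne'⟩
    refine ⟨y, hy, hσy, hy0, hy1, ?_, hc0, hc1, ?_, hrad, hres⟩
    · rw [hy2]
      have hl : ∀ l : ZMod p, ((fun l => algebraMap (MvPolynomial (Fin 4) k) (Localization.Away hh) (X ((![0, 1, 2] : Fin 3 → Fin 4) l))) 2 + (((![1, 0] : Fin 2 → ℕ) (Fin.succ (0 : Fin 1)) : ℕ) : (Localization.Away hh)) * ((l.val : (Localization.Away hh)) * (fun l => algebraMap (MvPolynomial (Fin 4) k) (Localization.Away hh) (X ((![0, 1, 2] : Fin 3 → Fin 4) l))) 0)) = (fun l => algebraMap (MvPolynomial (Fin 4) k) (Localization.Away hh) (X ((![0, 1, 2] : Fin 3 → Fin 4) l))) 2 := fun l => by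
        simp only [Matrix.cons_val_succ, Matrix.cons_val_zero, Nat.cast_zero, zero_mul, add_zero]
      rw [Finset.prod_congr rfl fun l _ => hl l, Finset.prod_const, Finset.card_univ, ZMod.card, ← pow_mul]
    · refine hc2.trans ?_
      simp only [Matrix.cons_val_succ, Matrix.cons_val_zero, Nat.cast_zero, zero_mul, map_zero, add_zero, Finset.prod_const,
        Finset.card_univ, ZMod.card, pow_mul]
      rfl

end Summit.ResolutionOfSingularities.ResolutionOfSingularities.Theorems.WildQuotientResolution.S1.KillCert.Cusp

end
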